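import Mathlib

/-!
# Sketch — crux-ideate stmt-QuantumFields-8780 (ConvexGribovBody.CovarianceBound), ideator k=1, round 1

First-lemma signatures for the two idea cards (they need not be proved here; they must elaborate).
Namespace per CRUX PROTOCOL: `Summit.QuantumFields.YangMills.Cruxes.CovarianceBound.<Slug>`.
-/

namespace Summit.QuantumFields.YangMills.Cruxes.CovarianceBound.TracedSchurBudgetEfronTransfer

open Real

/-- Card `traced-schur-budget-efron-transfer`, first lemma S1 (kinematic, matrix form):
SCHUR BUDGET INEQUALITY. For a real symmetric positive-semidefinite block matrix `[[A, B], [Bᵀ, C]]`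
with `C` positive definite, the "horizon form" `tr (B C⁻¹ Bᵀ)` is at most `tr A` (the Schur
complement `A - B C⁻¹ Bᵀ` is positive semidefinite, so its trace is non-negative).
Use: `A` = lowest-momentum-shell block of the lattice Faddeev–Popov operator `M(𝒜) = -Δ - ad(𝒜)·∇`
(= `k̂²_min • 1`, trace `2·3·dim 𝔤 · k̂²_min`; the zero-mode contribution is traceless), `B` = the
couplings `V_{k,q} = -i k · ad(Ã(q-k))`, `C` = `M` compressed to the remaining non-constant modes.
Result: the shared-budget ("ellipsoid") inequality `σ_F(𝒜) ≤ 1` for every `𝒜` in the Gribov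
region, configurationwise, in every volume. -/
def SchurBudget : Prop :=
  ∀ (m n : Type) [Fintype m] [Fintype n] [DecidableEq m] [DecidableEq n]
    (A : Matrix m m ℝ) (B : Matrix m n ℝ) (C : Matrix n n ℝ),
    C.PosDef → (Matrix.fromBlocks A B B.transpose C).PosSemidef →
      (B * C⁻¹ * B.transpose).trace ≤ A.trace

/-- Monotone refinement that makes the budget EXPLICIT: replacing `C` by a larger
constant-coefficient majorant `C₊ ≥ C` (on the lattice: `M ≤ (3/2)(-Δ) + c₀`, `c₀ = ½ sup ‖ad 𝒜‖²`)
only decreases the horizon form, so `σ̃(𝒜) := tr(B C₊⁻¹ Bᵀ)/tr A ≤ σ_F(𝒜) ≤ 1` with `σ̃` an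
explicit positive quadratic form in the Fourier modes of `𝒜`. -/
def SchurBudgetMono : Prop :=
  ∀ (m n : Type) [Fintype m] [Fintype n] [DecidableEq m] [DecidableEq n]
    (B : Matrix m n ℝ) (C Cmaj : Matrix n n ℝ),
    C.PosDef → (Cmaj - C).PosSemidef →
      (B * Cmaj⁻¹ * B.transpose).trace ≤ (B * C⁻¹ * B.transpose).trace

/-- The `p = 0` step of the kinematic cap, Faddeev–Popov-free (Zwanziger 1991, re-derived): along
the large abelian gauge transformations `g(y) = exp(2π n y_j T / L)` the minimal Coulomb functional
is the sinusoid `n ↦ h cos(2πn/L) + a sin(2πn/L)` (`h = Re tr W_j`, `a` = a Cartan component of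
the zero mode `Σ_y 𝒜_j(y)`); absolute minimality says the grid maximum is at `n = 0`, whence
`|a| ≤ h tan(π/L)`, i.e. `‖Σ_y 𝒜_j(y)‖ ≤ C L²` and `cov(p=0) ≤ C' L` configurationwise. -/
def GridMaximalSinusoid : Prop :=
  ∀ (L : ℕ), 3 ≤ L → ∀ (h a : ℝ), 0 < h →
    (∀ n : ℤ, h * Real.cos (2 * π * n / L) + a * Real.sin (2 * π * n / L) ≤ h) →
      |a| ≤ h * Real.tan (π / L)

end Summit.QuantumFields.YangMills.Cruxes.CovarianceBound.TracedSchurBudgetEfronTransfer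

namespace Summit.QuantumFields.YangMills.Cruxes.CovarianceBound.CoulombGaugeRandomHomogenisation

/-- Card `coulomb-gauge-random-homogenisation`, first lemma (the deterministic
"mean flux is slaved to the energy excess" estimate of quantitative homogenisation, in the
linearised = abelian quadratic model of the slice Coulomb functional).
Setting: a finite "box-like" graph — vertices `V`, edges `E` with tail/head maps `tl hd`, a direction
class `cls : E → J`, and coordinate functions `x j : V → ℝ` with
`x j (hd e) - x j (tl e) = if cls e = j then 1 else 0` (this is exactly what a free-boundary
lattice box provides).  Energy `F ψ = ½ Σ_e (ψ (hd e) - ψ (tl e) + a e)²` (`ψ` = infinitesimal gauge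
transformation, `a` = the given link field, `ψ (hd e) - ψ (tl e) + a e` = the gauge-transformed
link = the FLUX).  Claim: for EVERY `φ`, `½ Σ_j n_j · Ā_j(φ)² ≤ F φ - inf F`, where `Ā_j` is the
mean flux over the `n_j` edges of class `j` — because `φ - Σ_j Ā_j · x j` is an admissible
(free-boundary) competitor that removes the mean flux exactly.  Consequence on the torus slice:
the block-averaged Coulomb-gauge field, i.e. the INFRARED power `Σ_{|p| ≲ 1/R} cov_p`, is bounded
by the superadditivity defect `F_min(torus) - Σ_blocks F_min(block, free)` of the minimal Coulomb
functional at block scale `R` (exact in the quadratic model, BCH errors `O(R‖Ā‖)` in general). -/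
def MeanFluxLeEnergyExcess : Prop :=
  ∀ (V E J : Type) [Fintype V] [Fintype E] [Fintype J] [DecidableEq J]
    (tl hd : E → V) (cls : E → J) (x : J → V → ℝ),
    (∀ e j, x j (hd e) - x j (tl e) = if cls e = j then 1 else 0) →
    ∀ (a : E → ℝ) (φ : V → ℝ),
      let F : (V → ℝ) → ℝ := fun ψ => (1 / 2) * ∑ e, (ψ (hd e) - ψ (tl e) + a e) ^ 2
      let n : J → ℕ := fun j => (Finset.univ.filter fun e => cls e = j).card
      let Abar : J → ℝ := fun j =>
        (∑ e ∈ Finset.univ.filter (fun e => cls e = j), (φ (hd e) - φ (tl e) + a e)) / (n j : ℝ)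
      (1 / 2) * ∑ j, (n j : ℝ) * Abar j ^ 2 ≤ F φ - ⨅ ψ, F ψ

end Summit.QuantumFields.YangMills.Cruxes.CovarianceBound.CoulombGaugeRandomHomogenisation

namespace Summit.QuantumFields.YangMills.Cruxes.CovarianceBound.TracedSchurBudgetEfronTransfer

/-- PAIR COMPRESSION, step 1 (inverse of a compression ≤ compression of the inverse): for a real symmetric positive
definite block matrix `X = [[P, R], [Rᵀ, S]]`, the `₁₁` block of `X⁻¹` dominates `P⁻¹` (it equals `(P - R S⁻¹ Rᵀ)⁻¹` and
`P - R S⁻¹ Rᵀ ≤ P`).  Use: lower bounds on diagonal blocks of the compressed ghost propagator `(QMQ)⁻¹` from the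
corresponding blocks of `QMQ` alone. -/
def InverseBlockDominates : Prop :=
  ∀ (m n : Type) [Fintype m] [Fintype n] [DecidableEq m] [DecidableEq n]
    (P : Matrix m m ℝ) (R : Matrix m n ℝ) (S : Matrix n n ℝ),
    (Matrix.fromBlocks P R R.transpose S).PosDef →
      (((Matrix.fromBlocks P R R.transpose S)⁻¹).toBlocks₁₁ - P⁻¹).PosSemidef

/-- PAIR COMPRESSION, step 2 (the `{q, -q}` block): a real symmetric PSD `2 × 2` matrix with equal diagonal entries
`t > 0` (on the lattice: `t = q̂²`, the first-order FP term vanishing on real colour vectors) is `≤ 2t·1`, so its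
inverse, when it exists, is `≥ (2t)⁻¹·1`.  With step 1: every `{q,-q}`-diagonal block of `(QMQ)⁻¹` is `≥ 1/(2q̂²)`
CONFIGURATIONWISE on the Gribov region — the Dell'Antonio–Zwanziger weight survives exactly on diagonal blocks; only
cross-momentum coherence of the ghost propagator can spoil the explicit `1/q²` budget. -/
def PairBlockBound : Prop :=
  ∀ (t x : ℝ), 0 < t → (!![t, x; x, t] : Matrix (Fin 2) (Fin 2) ℝ).PosSemidef →
    ((2 * t) • (1 : Matrix (Fin 2) (Fin 2) ℝ) - !![t, x; x, t]).PosSemidef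

end Summit.QuantumFields.YangMills.Cruxes.CovarianceBound.TracedSchurBudgetEfronTransfer
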